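/-
Copyright: the b2b-balaban T⁴-continuum CRUX team, row NE7b, leaf lineage `t4-ne7b-formalise-leaf-02` (gen 130). Project licence.
-/
import Mathlib.Analysis.Analytic.IteratedFDeriv
import Mathlib.Analysis.InnerProductSpace.PiL2
import Mathlib.LinearAlgebra.CrossProduct

/-!
# THE PLAQUETTE CUBIC'S BLOCK TABLE IN THE KERNEL: for `P = g·P₃`, `P₃(x) = det(x₀,x₁,x₂) + det(x₀,x₁,x₃) − det(x₀,x₂,x₃) − det(x₁,x₂,x₃)`
# (`x_b ∈ ℝ³` the four bond blocks of one plaquette), EVERY block fibre sum of the third-derivative block entries is `≤ 6·|g|` —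
# window-free, at every point (row NE7b, node U5c; letter (ℓ1) of the windowed road, the by-value half of `…ConvexWindowSuppliersLocal`
# §5: the desk's ρ-ne7bref-g75-1 «block row constant 6 per plaquette» AS A THEOREM)

Cell `pub-balaban`, sub-cell `t4`, spine estimate NE7b (`T4WeightBudget.RelWeightBound`; the cell's OWN estimate — NOT PRINTED in
[Bałaban 1983–89], NOT PROVED).  Crux-route work under `Spine/NE7b/` by the row's E-side ∕ key-readings leaf lineage; NOTHING of
Bałaban's is named or asserted; no `T4Continuum/Support` leaf typed; no `def`, no notation (the cubic's slot form, the block reader and the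
block projections are carried by coordinatewise characterising hypotheses, all inhabited in §4); zero `sorry`.  Imports: Mathlib ONLY —
independent of the hub's olean frontier; the junction with `…ConvexWindowSuppliersLocal` §5 BY NAME is the sequel `…PlaquetteCubicWindow`.

WHY.  `…ConvexWindowSuppliersLocal` §5 (this lineage, p372269) types the desk's block Schur test — block fibre sums of the entries
`‖D³P(z) ∘ (Q_{r0}, Q_{r1}, Q_{r2})‖_op` over the middle ∕ last block index bounded by `M` ON the window ⟹ modulus `2σ − (‖D²P(0)‖ + M·a)`
on T-61's per-bond window — and DISPLAYS `M`; the refuter VALUED it (ρ-ne7bref-g75-1 «`M_latt(1) = 36` exactly at leading order = block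
row constant 6 per plaquette × 6 plaquettes per bond», PRICING-NE7b v90 F467) and books the road's standing debt as «BY VALUE NOTHING: no
`c`, no `λ`, no window radius … is displayed anywhere on the row» (v101 §3 (iii)).  THIS FILE puts the first such number in the kernel,
for the leading anharmonic term of the plaquette action at the flat background — the cubic `g·P₃` in the bond blocks `x_b ∈ ℝ³ ≅ su(2)`
(its identification with the `g³` Taylor term of `g⁻²(1 − ½ Re tr U(∂p))` by BCH is idea-1's T-71 ∕ the desk's F463 (i): READ here, not
re-derived): the per-plaquette block row ∕ column constant IS `6` (times `|g|`).  Mechanism: `D³P₃` is CONSTANT — `D³P(z)[v] = Σ_{σ ∈ S₃}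
f(v ∘ σ)` for `P = (x ↦ f(x,x,x))` (Mathlib's `ContinuousMultilinearMap.iteratedFDeriv_comp_diagonal`); on block-projected arguments each
signed determinant term survives exactly when the three blocks match its support and is then `≤ ‖m₀‖‖m₁‖‖m₂‖` (Hadamard); and through each
bond block pass `3` signed terms × `2` orders of the partner slots = `6` (kernel `decide`).

WHAT IS PROVED ([folklore] multilinear algebra on `E = EuclideanSpace ℝ (Fin n)` with a bond-block chart `e : Fin n ≃ Fin 4 × Fin 3`; the
BLOCK READER `β v b : Fin 3 → ℝ`, `β v b i = v (e.symm (b, i))` (hypothesis `hβ`), the BLOCK PROJECTIONS `(Q b x) j = x j` on block `b`, `0`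
off it (hypothesis `hQ`); `det(u,v,w) = u ⬝ᵥ (v ⨯₃ w)` the triple product):
* §1 `det3_eq_zero_of_or` (a zero argument kills the triple product).
* §2 blocks: `block_proj` (`β (Q_{b'} v) b = [b = b']·β v b`), `block_dotProduct_self_le` ∕ `sqrt_…` (`|β v b| ≤ ‖v‖`), **`abs_det3_blocks_le`**
  (`|det(β u a, β v b, β w c)| ≤ ‖u‖‖v‖‖w‖`: HADAMARD — Lagrange's identity twice, Mathlib's `cross_dot_cross` — then `|β v b| ≤ ‖v‖`; the bare
  Hadamard inequality is stated on its own in the sibling `…PlaquetteCubicConstants` of leaf-02 g129, not re-declared here); from `hQ` alone: `proj_sum` (`Σ_b Q_b = id`), `proj_idem`, `norm_proj_sq`, `proj_pythagoras`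
  (`Σ_b ‖Q_b x‖² = ‖x‖²`) — `…ConvexWindowSuppliersLocal` §5's three structural hypotheses for the bond blocks.
* §3 the cubic: with `f` ANY continuous trilinear form whose values are `g·𝔭(m)`, `𝔭` the SLOT FORM of `P₃` (slot `s` of the signed term
  `(a,b,c)` read in block `a ∕ b ∕ c`; hypothesis `hf`, so `f(x,x,x) = g·P₃(x)`): `det3_proj` ∕ `abs_det3_proj_le` (a signed term on
  block-projected arguments = the term if the blocks match, else `0`; `≤ [match]·‖v₀‖‖v₁‖‖v₂‖`), **`norm_blockEntry_le`**
  (`‖D³P(z) ∘ (Q_{r0},Q_{r1},Q_{r2})‖_op ≤ |g|·N(r)`, `N(r)` = number of pairs (`σ`, signed term) matched by `r ∘ σ`), **`count_matches_eq_six`**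
  (`Σ_{r : r s = b} N(r) = 6` for every slot `s` and block `b`; `decide`), and the table **`blockFibreSum_thirdDeriv_le`**:
  `Σ_{r : r s = b} ‖D³P(z) ∘ (Q_{r0},Q_{r1},Q_{r2})‖_op ≤ 6·|g|` — the `hrow` (`s = 1`) and `hcol` (`s = 2`) of file (2) §5 BY VALUE, any `z`.
* §4 the hypotheses INHABITED: `exists_blockReader`, **`exists_proj`** (`Q_b = Σ_{j ∈ block b} proj_j ⊗ e_j`), **`exists_slotForm`** (`g·𝔭` IS a
  continuous trilinear form: `24` signed coordinate monomials — Mathlib's `mkPiAlgebra` composed with coordinate projections; `ring`).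

NOT HERE (honest): that `g·P₃` IS the cubic Taylor term of the SU(2) Wilson plaquette action in these coordinates (BCH; idea-1 T-71, refuter
F463 (i) — read, not re-derived); the quartic and higher Taylor terms and the curvature corrections about a non-flat background (the desk:
`O(ε_k)` relative, F463 (iv)) — they enter file (2)'s `M` additively through their own block tables; the sum over the plaquettes of a torus
(`M ≤ 6ν|g|`, `ν` = plaquettes per bond = `2(d−1)`, the cell count — a sequel); the window END (sequel `…PlaquetteCubicWindow`); the sharpness
`= 6`; `σ`, `g`, the per-bond radius and the chart in which print's window is a product of per-bond balls ((A3) ∕ (A1c); refuter v101 §3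
(i)–(ii)); anything of Bałaban's.  BY-NAME EFFECT ON THE WALL: NONE (a by-value supplier for ONE displayed letter of ONE term at the flat
background).  NE7b NOT PRINTED ∕ NOT PROVED; spine PROVED 0∕9; rung (B)+1 on a FINITE torus — NOT infinite volume, NOT the mass gap, NOT Clay.
HONEST DEPENDENCY: continuum YM on T⁴ ⇐ BetaPertH ∧ nine spine estimates (0/9 proved); BetaPertH ⇐ (D1) ∧ (D4) ∧ CAP+tail.
-/

set_option autoImplicit false

noncomputable section

open Real Set Finset Equiv
open scoped Matrix

namespace Summit.QuantumFields.BalabanUV.T4Continuum.NE7b.PlaquetteCubicBlockTable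

variable {n : ℕ}

/-! ## §1 The triple product with a vanishing argument -/

/-- The triple product `det(a,b,c) = a ⬝ᵥ (b ⨯₃ c)` vanishes when one of its arguments does. [folklore] -/
theorem det3_eq_zero_of_or {a b c : Fin 3 → ℝ} (h : a = 0 ∨ b = 0 ∨ c = 0) : a ⬝ᵥ b ⨯₃ c = 0 := by
  rcases h with rfl | rfl | rfl
  · exact zero_dotProduct _
  · rw [map_zero, LinearMap.zero_apply, dotProduct_zero]
  · rw [map_zero, dotProduct_zero]

/-! ## §2 Bond blocks of a coordinate Euclidean space: the block reader `β` and the block projections `Q`, characterised coordinatewise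

`e : Fin n ≃ Fin 4 × Fin 3` is the bond-block chart (four bond blocks of three colour coordinates); the BLOCK READER `β v b : Fin 3 → ℝ` is
the `b`-block of `v` (`β v b i = v (e.symm (b, i))`) and the BLOCK PROJECTIONS satisfy `(Q b x) j = x j` on block `b`, `0` off it.  Both are
quantified with their coordinatewise characterisations `hβ`, `hQ` as hypotheses (inhabited: §4) — no definition is introduced. -/

section Blocks

variable (e : Fin n ≃ Fin 4 × Fin 3) (β : EuclideanSpace ℝ (Fin n) → Fin 4 → Fin 3 → ℝ)
  (Q : Fin 4 → EuclideanSpace ℝ (Fin n) →L[ℝ] EuclideanSpace ℝ (Fin n))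

/-- **THE BLOCK READING OF A PROJECTION**: the `b`-block of `Q b' v` is the `b`-block of `v` if `b = b'`, else the zero `3`-vector. [folklore] -/
theorem block_proj (hβ : ∀ v b i, β v b i = v (e.symm (b, i))) (hQ : ∀ b x j, Q b x j = if (e j).1 = b then x j else 0)
    (b b' : Fin 4) (v : EuclideanSpace ℝ (Fin n)) : β (Q b' v) b = if b = b' then β v b else 0 := by
  funext i
  rw [hβ, hQ, Equiv.apply_symm_apply]
  split_ifs with h
  · rw [hβ]
  · rfl

/-- The squared Euclidean length of the `b`-block of `v` is at most `‖v‖²` (a sub-sum of the coordinate squares). [folklore] -/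
theorem block_dotProduct_self_le (hβ : ∀ v b i, β v b i = v (e.symm (b, i))) (b : Fin 4) (v : EuclideanSpace ℝ (Fin n)) :
    β v b ⬝ᵥ β v b ≤ ‖v‖ ^ 2 := by
  have hinj : Function.Injective (fun i : Fin 3 => e.symm (b, i)) := fun i j hij => by
    simpa using congrArg (fun k => (e k).2) hij
  calc _ = ∑ i : Fin 3, ‖v (e.symm (b, i))‖ ^ 2 := by simp only [dotProduct, hβ, Real.norm_eq_abs, sq, abs_mul_abs_self]
    _ = ∑ j ∈ Finset.univ.image (fun i : Fin 3 => e.symm (b, i)), ‖v j‖ ^ 2 := by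
        rw [Finset.sum_image fun i _ j _ h => hinj h]
    _ ≤ ‖v‖ ^ 2 := by
        rw [EuclideanSpace.norm_sq_eq]
        exact Finset.sum_le_sum_of_subset_of_nonneg (Finset.subset_univ _) fun j _ _ => sq_nonneg _

/-- `|v|_b| ≤ ‖v‖`. [folklore] -/
theorem sqrt_block_dotProduct_self_le (hβ : ∀ v b i, β v b i = v (e.symm (b, i))) (b : Fin 4) (v : EuclideanSpace ℝ (Fin n)) :
    √(β v b ⬝ᵥ β v b) ≤ ‖v‖ := by
  rw [← Real.sqrt_sq (norm_nonneg v)]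
  exact Real.sqrt_le_sqrt (block_dotProduct_self_le e β hβ b v)

/-- **HADAMARD IN BLOCKS**: `|det(u|_a, v|_b, w|_c)| ≤ ‖u‖·‖v‖·‖w‖` — Lagrange's identity twice (Mathlib's `cross_dot_cross`) gives Hadamard
`(p·(q × r))² ≤ |p|²|q|²|r|²` for three `3`-vectors (the sibling `…PlaquetteCubicConstants` (leaf-02 g129) states that inequality on its own;
here it is a step), then `|v|_b| ≤ ‖v‖`. [folklore] -/
theorem abs_det3_blocks_le (hβ : ∀ v b i, β v b i = v (e.symm (b, i))) (a b c : Fin 4) (u v w : EuclideanSpace ℝ (Fin n)) :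
    |β u a ⬝ᵥ β v b ⨯₃ β w c| ≤ ‖u‖ * ‖v‖ * ‖w‖ := by
  have hnn : ∀ p : Fin 3 → ℝ, 0 ≤ p ⬝ᵥ p := fun p => Finset.sum_nonneg fun i _ => mul_self_nonneg _
  -- Hadamard for the three block vectors `p, q, r`
  have hH : ∀ p q r : Fin 3 → ℝ, |p ⬝ᵥ q ⨯₃ r| ≤ √(p ⬝ᵥ p) * √(q ⬝ᵥ q) * √(r ⬝ᵥ r) := by
    intro p q r
    have h1 : (p ⬝ᵥ q ⨯₃ r) ^ 2 + (p ⨯₃ (q ⨯₃ r)) ⬝ᵥ (p ⨯₃ (q ⨯₃ r)) = (p ⬝ᵥ p) * ((q ⨯₃ r) ⬝ᵥ (q ⨯₃ r)) := by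
      rw [cross_dot_cross, dotProduct_comm (q ⨯₃ r) p]; ring
    have h2 : (q ⨯₃ r) ⬝ᵥ (q ⨯₃ r) = (q ⬝ᵥ q) * (r ⬝ᵥ r) - (q ⬝ᵥ r) * (q ⬝ᵥ r) := by
      rw [cross_dot_cross, dotProduct_comm r q]
    have hsq : (p ⬝ᵥ q ⨯₃ r) ^ 2 ≤ (p ⬝ᵥ p) * ((q ⬝ᵥ q) * (r ⬝ᵥ r)) := by
      nlinarith [sq_nonneg (q ⬝ᵥ r), hnn (p ⨯₃ (q ⨯₃ r)), hnn p]
    rw [← Real.sqrt_mul (hnn p), ← Real.sqrt_mul (mul_nonneg (hnn p) (hnn q)), mul_assoc, ← Real.sqrt_sq_eq_abs]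
    exact Real.sqrt_le_sqrt hsq
  exact (hH _ _ _).trans
    (mul_le_mul (mul_le_mul (sqrt_block_dotProduct_self_le e β hβ a u) (sqrt_block_dotProduct_self_le e β hβ b v)
      (Real.sqrt_nonneg _) (norm_nonneg _)) (sqrt_block_dotProduct_self_le e β hβ c w) (Real.sqrt_nonneg _)
      (mul_nonneg (norm_nonneg _) (norm_nonneg _)))

/-- The block projections sum to the identity. [folklore] -/
theorem proj_sum (hQ : ∀ b x j, Q b x j = if (e j).1 = b then x j else 0) (x : EuclideanSpace ℝ (Fin n)) :
    ∑ b, Q b x = x := by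
  ext j
  simp [WithLp.ofLp_sum, hQ]

/-- The block projections are idempotent. [folklore] -/
theorem proj_idem (hQ : ∀ b x j, Q b x j = if (e j).1 = b then x j else 0) (b : Fin 4) (x : EuclideanSpace ℝ (Fin n)) :
    Q b (Q b x) = Q b x := by
  ext j
  rw [hQ, hQ]
  split_ifs <;> rfl

/-- `‖Q_b x‖²` is the sum of the coordinate squares over block `b`. [folklore] -/
theorem norm_proj_sq (hQ : ∀ b x j, Q b x j = if (e j).1 = b then x j else 0) (b : Fin 4) (x : EuclideanSpace ℝ (Fin n)) :
    ‖Q b x‖ ^ 2 = ∑ j ∈ univ.filter (fun j => (e j).1 = b), ‖x j‖ ^ 2 := by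
  rw [EuclideanSpace.norm_sq_eq, Finset.sum_filter]
  refine Finset.sum_congr rfl fun j _ => ?_
  rw [hQ]; split_ifs <;> simp

/-- Pythagoras over the blocks: `Σ_b ‖Q_b x‖² = ‖x‖²`. [folklore] -/
theorem proj_pythagoras (hQ : ∀ b x j, Q b x j = if (e j).1 = b then x j else 0) (x : EuclideanSpace ℝ (Fin n)) :
    ∑ b, ‖Q b x‖ ^ 2 = ‖x‖ ^ 2 := by
  simp_rw [norm_proj_sq e Q hQ]
  rw [EuclideanSpace.norm_sq_eq x, ← Finset.sum_fiberwise univ (fun j => (e j).1) (fun j => ‖x j‖ ^ 2)]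

end Blocks

/-! ## §3 The plaquette cubic: its slot form, its third derivative, the block entries and the block table

The SU(2) plaquette cubic at the flat background (refuter F463 (i), idea-1 T-71; BCH), in the bond blocks `x_b ∈ ℝ³ ≅ su(2)`:
`P₃(x) = det(x₀,x₁,x₂) + det(x₀,x₁,x₃) − det(x₀,x₂,x₃) − det(x₁,x₂,x₃)` (`det` = the triple product).  Its SLOT FORM reads slot `s` of each
signed term `(a,b,c)` in block `a ∕ b ∕ c`: `𝔭(m) = det(m₀|₀,m₁|₁,m₂|₂) + det(m₀|₀,m₁|₁,m₂|₃) − det(m₀|₀,m₁|₂,m₂|₃) − det(m₀|₁,m₁|₂,m₂|₃)`, so that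
`P₃(x) = 𝔭(x,x,x)` and `D³P₃[v₀,v₁,v₂] = Σ_{σ ∈ S₃} 𝔭(v_{σ0},v_{σ1},v_{σ2})`.  Below `f` is ANY continuous trilinear form with `f m = g·𝔭(m)`
(hypothesis `hf`, written with the block reader `β`; `g` the coupling prefactor; §4 exhibits such an `f`). -/

section Cubic

variable (e : Fin n ≃ Fin 4 × Fin 3) (β : EuclideanSpace ℝ (Fin n) → Fin 4 → Fin 3 → ℝ)
  (Q : Fin 4 → EuclideanSpace ℝ (Fin n) →L[ℝ] EuclideanSpace ℝ (Fin n))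

/-- **A SIGNED-DETERMINANT TERM ON PROJECTED ARGUMENTS**: `det((Q_{b₀}v₀)|_a, (Q_{b₁}v₁)|_b, (Q_{b₂}v₂)|_c)` is `det(v₀|_a, v₁|_b, v₂|_c)` when
`(b₀, b₁, b₂) = (a, b, c)` and vanishes otherwise. [folklore] -/
theorem det3_proj (hβ : ∀ v b i, β v b i = v (e.symm (b, i))) (hQ : ∀ b x j, Q b x j = if (e j).1 = b then x j else 0)
    (a b c b₀ b₁ b₂ : Fin 4) (v₀ v₁ v₂ : EuclideanSpace ℝ (Fin n)) :
    β (Q b₀ v₀) a ⬝ᵥ β (Q b₁ v₁) b ⨯₃ β (Q b₂ v₂) c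
      = if b₀ = a ∧ b₁ = b ∧ b₂ = c then β v₀ a ⬝ᵥ β v₁ b ⨯₃ β v₂ c else 0 := by
  rw [block_proj e β Q hβ hQ a b₀ v₀, block_proj e β Q hβ hQ b b₁ v₁, block_proj e β Q hβ hQ c b₂ v₂]
  by_cases h : b₀ = a ∧ b₁ = b ∧ b₂ = c
  · rw [if_pos h, if_pos h.1.symm, if_pos h.2.1.symm, if_pos h.2.2.symm]
  · rw [if_neg h]
    apply det3_eq_zero_of_or
    by_cases h0 : a = b₀
    · by_cases h1 : b = b₁
      · exact Or.inr (Or.inr (if_neg fun h2 => h ⟨h0.symm, h1.symm, h2.symm⟩))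
      · exact Or.inr (Or.inl (if_neg h1))
    · exact Or.inl (if_neg h0)

/-- The same term, bounded: `≤ [(b₀,b₁,b₂) = (a,b,c)]·‖v₀‖‖v₁‖‖v₂‖` (Hadamard in blocks). [folklore] -/
theorem abs_det3_proj_le (hβ : ∀ v b i, β v b i = v (e.symm (b, i))) (hQ : ∀ b x j, Q b x j = if (e j).1 = b then x j else 0)
    (a b c b₀ b₁ b₂ : Fin 4) (v₀ v₁ v₂ : EuclideanSpace ℝ (Fin n)) :
    |β (Q b₀ v₀) a ⬝ᵥ β (Q b₁ v₁) b ⨯₃ β (Q b₂ v₂) c|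
      ≤ ((if b₀ = a ∧ b₁ = b ∧ b₂ = c then 1 else 0 : ℕ) : ℝ) * (‖v₀‖ * ‖v₁‖ * ‖v₂‖) := by
  rw [det3_proj e β Q hβ hQ]
  split_ifs
  · rw [Nat.cast_one, one_mul]; exact abs_det3_blocks_le e β hβ a b c v₀ v₁ v₂
  · simp

/-- **THE BLOCK ENTRIES OF `D³P`**: for `P = (x ↦ f(x,x,x))` with `f m = g·𝔭(m)` and a block triple `r`, at EVERY point `z`,
`‖D³P(z) ∘ (Q_{r0}, Q_{r1}, Q_{r2})‖_op ≤ |g|·N(r)` with `N(r)` the number of pairs (`σ ∈ S₃`, signed term `(a,b,c)`) such that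
`(r(σ0), r(σ1), r(σ2)) = (a,b,c)` — the third derivative of a cubic is the constant `D³P(z)[v] = Σ_σ f(v ∘ σ)` (Mathlib's
`ContinuousMultilinearMap.iteratedFDeriv_comp_diagonal`), each `f(v ∘ σ)` on block-projected arguments is a sum of matched signed
determinants, and each matched determinant is `≤ ‖m₀‖‖m₁‖‖m₂‖` (Hadamard in blocks). [folklore] -/
theorem norm_blockEntry_le (hβ : ∀ v b i, β v b i = v (e.symm (b, i))) (hQ : ∀ b x j, Q b x j = if (e j).1 = b then x j else 0)
    (f : ContinuousMultilinearMap ℝ (fun _ : Fin 3 => EuclideanSpace ℝ (Fin n)) ℝ) (g : ℝ)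
    (hf : ∀ m, f m = g * (β (m 0) 0 ⬝ᵥ β (m 1) 1 ⨯₃ β (m 2) 2 + β (m 0) 0 ⬝ᵥ β (m 1) 1 ⨯₃ β (m 2) 3
      - β (m 0) 0 ⬝ᵥ β (m 1) 2 ⨯₃ β (m 2) 3 - β (m 0) 1 ⬝ᵥ β (m 1) 2 ⨯₃ β (m 2) 3))
    (z : EuclideanSpace ℝ (Fin n)) (r : Fin 3 → Fin 4) :
    ‖(iteratedFDeriv ℝ 3 (fun x => f (fun _ => x)) z).compContinuousLinearMap (fun s => Q (r s))‖ ≤ |g| *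
      ((∑ σ : Equiv.Perm (Fin 3),
        ((if r (σ 0) = 0 ∧ r (σ 1) = 1 ∧ r (σ 2) = 2 then 1 else 0) + (if r (σ 0) = 0 ∧ r (σ 1) = 1 ∧ r (σ 2) = 3 then 1 else 0)
          + (if r (σ 0) = 0 ∧ r (σ 1) = 2 ∧ r (σ 2) = 3 then 1 else 0) + (if r (σ 0) = 1 ∧ r (σ 1) = 2 ∧ r (σ 2) = 3 then 1 else 0)) : ℕ) : ℝ) := by
  refine ContinuousMultilinearMap.opNorm_le_bound (by positivity) fun m => ?_
  rw [ContinuousMultilinearMap.compContinuousLinearMap_apply, ContinuousMultilinearMap.iteratedFDeriv_comp_diagonal,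
    Real.norm_eq_abs, Nat.cast_sum, Finset.mul_sum, Finset.sum_mul]
  refine (Finset.abs_sum_le_sum_abs _ _).trans (Finset.sum_le_sum fun σ _ => ?_)
  have hprod : ‖m (σ 0)‖ * ‖m (σ 1)‖ * ‖m (σ 2)‖ = ∏ i, ‖m i‖ := by
    rw [← Equiv.prod_comp σ (fun i => ‖m i‖), Fin.prod_univ_three]
  -- the slot form on block-projected, permuted arguments: a count of matches times Hadamard
  have h1 := abs_det3_proj_le e β Q hβ hQ 0 1 2 (r (σ 0)) (r (σ 1)) (r (σ 2)) (m (σ 0)) (m (σ 1)) (m (σ 2))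
  have h2 := abs_det3_proj_le e β Q hβ hQ 0 1 3 (r (σ 0)) (r (σ 1)) (r (σ 2)) (m (σ 0)) (m (σ 1)) (m (σ 2))
  have h3 := abs_det3_proj_le e β Q hβ hQ 0 2 3 (r (σ 0)) (r (σ 1)) (r (σ 2)) (m (σ 0)) (m (σ 1)) (m (σ 2))
  have h4 := abs_det3_proj_le e β Q hβ hQ 1 2 3 (r (σ 0)) (r (σ 1)) (r (σ 2)) (m (σ 0)) (m (σ 1)) (m (σ 2))
  rw [hf, abs_mul, ← hprod, mul_assoc]
  refine mul_le_mul_of_nonneg_left ?_ (abs_nonneg g)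
  push_cast
  refine (abs_sub _ _).trans ((add_le_add ((abs_sub _ _).trans (add_le_add ((abs_add_le _ _).trans (add_le_add h1 h2)) h3)) h4).trans
    (le_of_eq ?_))
  push_cast
  ring

/-- **THE COUNT** (kernel `decide`): for each slot `s` and block `b`, summing over the block triples `r` with `r s = b` the number of pairs
(`σ ∈ S₃`, signed term `(a,b,c)`) with `(r(σ0), r(σ1), r(σ2)) = (a,b,c)` gives `6` = (3 terms containing `b`) × (2 orders of the partners). -/
theorem count_matches_eq_six (s : Fin 3) (b : Fin 4) :
    ∑ r ∈ (univ : Finset (Fin 3 → Fin 4)).filter (fun r => r s = b), ∑ σ : Equiv.Perm (Fin 3),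
      ((if r (σ 0) = 0 ∧ r (σ 1) = 1 ∧ r (σ 2) = 2 then 1 else 0) + (if r (σ 0) = 0 ∧ r (σ 1) = 1 ∧ r (σ 2) = 3 then 1 else 0)
        + (if r (σ 0) = 0 ∧ r (σ 1) = 2 ∧ r (σ 2) = 3 then 1 else 0) + (if r (σ 0) = 1 ∧ r (σ 1) = 2 ∧ r (σ 2) = 3 then 1 else 0) : ℕ)
      = 6 := by
  revert s b
  decide

/-- **THE BLOCK TABLE OF THE PLAQUETTE CUBIC: EVERY BLOCK FIBRE SUM IS `≤ 6|g|`** (the desk's ρ-ne7bref-g75-1 «block row constant 6 per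
plaquette» as a theorem).  For `P = (x ↦ f(x,x,x))`, `f m = g·𝔭(m)`, every slot `s`, every bond block `b` and every point `z`:
`Σ_{r : r s = b} ‖D³P(z) ∘ (Q_{r0}, Q_{r1}, Q_{r2})‖_op ≤ 6·|g|` — window-free and background-free; `s = 1 ∕ 2` are the `hrow ∕ hcol` of
`…ConvexWindowSuppliersLocal` §5 BY VALUE. [folklore] -/
theorem blockFibreSum_thirdDeriv_le (hβ : ∀ v b i, β v b i = v (e.symm (b, i)))
    (hQ : ∀ b x j, Q b x j = if (e j).1 = b then x j else 0)
    (f : ContinuousMultilinearMap ℝ (fun _ : Fin 3 => EuclideanSpace ℝ (Fin n)) ℝ) (g : ℝ)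
    (hf : ∀ m, f m = g * (β (m 0) 0 ⬝ᵥ β (m 1) 1 ⨯₃ β (m 2) 2 + β (m 0) 0 ⬝ᵥ β (m 1) 1 ⨯₃ β (m 2) 3
      - β (m 0) 0 ⬝ᵥ β (m 1) 2 ⨯₃ β (m 2) 3 - β (m 0) 1 ⬝ᵥ β (m 1) 2 ⨯₃ β (m 2) 3))
    (z : EuclideanSpace ℝ (Fin n)) (s : Fin 3) (b : Fin 4) :
    ∑ r ∈ univ.filter (fun r : Fin 3 → Fin 4 => r s = b),
      ‖(iteratedFDeriv ℝ 3 (fun x => f (fun _ => x)) z).compContinuousLinearMap (fun i => Q (r i))‖ ≤ 6 * |g| := by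
  refine (Finset.sum_le_sum fun r _ => norm_blockEntry_le e β Q hβ hQ f g hf z r).trans ?_
  rw [← Finset.mul_sum, ← Nat.cast_sum, count_matches_eq_six s b, Nat.cast_ofNat, mul_comm]

end Cubic

/-! ## §4 The hypotheses inhabited: the block reader, the block projections, and the slot form as a continuous trilinear form -/

section Inhabited

variable (e : Fin n ≃ Fin 4 × Fin 3)

/-- **THE BLOCK READER EXISTS** (it is `v ↦ b ↦ i ↦ v (e.symm (b, i))`). [folklore] -/
theorem exists_blockReader : ∃ β : EuclideanSpace ℝ (Fin n) → Fin 4 → Fin 3 → ℝ, ∀ v b i, β v b i = v (e.symm (b, i)) :=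
  ⟨fun v b i => v (e.symm (b, i)), fun _ _ _ => rfl⟩

/-- **THE BLOCK PROJECTIONS EXIST**: `Q_b := Σ_{j in block b} proj_j ⊗ e_j` satisfies the coordinatewise characterisation. [folklore] -/
theorem exists_proj :
    ∃ Q : Fin 4 → EuclideanSpace ℝ (Fin n) →L[ℝ] EuclideanSpace ℝ (Fin n), ∀ b x j, Q b x j = if (e j).1 = b then x j else 0 := by
  classical
  refine ⟨fun b => ∑ j ∈ univ.filter (fun j => (e j).1 = b),
    (EuclideanSpace.proj j).smulRight (EuclideanSpace.single j (1 : ℝ)), fun b x j => ?_⟩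
  simp only [_root_.sum_apply, ContinuousLinearMap.smulRight_apply, PiLp.proj_apply, WithLp.ofLp_sum, WithLp.ofLp_smul,
    PiLp.ofLp_single, Finset.sum_apply, Pi.smul_apply, smul_eq_mul, Pi.single_apply, mul_ite, mul_one, mul_zero,
    Finset.sum_ite_eq, Finset.mem_filter, Finset.mem_univ, true_and]

/-- **THE SLOT FORM IS A CONTINUOUS TRILINEAR FORM**: for the block reader `β` and every `g`, `g·𝔭` is realised by
`g • (𝔇(0,1,2) + 𝔇(0,1,3) − 𝔇(0,2,3) − 𝔇(1,2,3))`, each `𝔇(a,b,c)` the six signed coordinate monomials of `det(m₀|_a, m₁|_b, m₂|_c)` (Mathlib's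
`mkPiAlgebra` composed with coordinate projections) — so the hypothesis `hf` of §3 is inhabited. [folklore] -/
theorem exists_slotForm (β : EuclideanSpace ℝ (Fin n) → Fin 4 → Fin 3 → ℝ) (hβ : ∀ v b i, β v b i = v (e.symm (b, i))) (g : ℝ) :
    ∃ f : ContinuousMultilinearMap ℝ (fun _ : Fin 3 => EuclideanSpace ℝ (Fin n)) ℝ,
      ∀ m, f m = g * (β (m 0) 0 ⬝ᵥ β (m 1) 1 ⨯₃ β (m 2) 2 + β (m 0) 0 ⬝ᵥ β (m 1) 1 ⨯₃ β (m 2) 3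
        - β (m 0) 0 ⬝ᵥ β (m 1) 2 ⨯₃ β (m 2) 3 - β (m 0) 1 ⬝ᵥ β (m 1) 2 ⨯₃ β (m 2) 3) := by
  -- one signed monomial: slot `s` reads coordinate `(t s, c s)`; `D a b c` = the six monomials of `det(m₀|_a, m₁|_b, m₂|_c)`
  let M : (Fin 3 → Fin 4) → (Fin 3 → Fin 3) → ContinuousMultilinearMap ℝ (fun _ : Fin 3 => EuclideanSpace ℝ (Fin n)) ℝ :=
    fun t c => (ContinuousMultilinearMap.mkPiAlgebra ℝ (Fin 3) ℝ).compContinuousLinearMap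
      fun s => EuclideanSpace.proj (e.symm (t s, c s))
  let D : Fin 4 → Fin 4 → Fin 4 → ContinuousMultilinearMap ℝ (fun _ : Fin 3 => EuclideanSpace ℝ (Fin n)) ℝ :=
    fun a b c => M ![a, b, c] ![0, 1, 2] - M ![a, b, c] ![0, 2, 1] - M ![a, b, c] ![1, 0, 2]
      + M ![a, b, c] ![1, 2, 0] + M ![a, b, c] ![2, 0, 1] - M ![a, b, c] ![2, 1, 0]
  refine ⟨g • (D 0 1 2 + D 0 1 3 - D 0 2 3 - D 1 2 3), fun m => ?_⟩
  simp only [D, M, smul_apply, add_apply, sub_apply, ContinuousMultilinearMap.compContinuousLinearMap_apply,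
    ContinuousMultilinearMap.mkPiAlgebra_apply, Fin.prod_univ_three, Matrix.cons_val_zero, Matrix.cons_val_one,
    Matrix.cons_val_two, Matrix.head_cons, Matrix.tail_cons, EuclideanSpace.coe_proj, smul_eq_mul, cross_apply, dotProduct,
    Fin.sum_univ_three, hβ]
  ring

end Inhabited

end Summit.QuantumFields.BalabanUV.T4Continuum.NE7b.PlaquetteCubicBlockTable

end
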